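import Summits.HubbardSuperconductivity.HubbardSuperconductivity.Theses.ParentFirstSMA
import Summits.HubbardSuperconductivity.HubbardSuperconductivity.Theorems.TwTipContinuation.Negative.TipNormalForm
import HarnessLib

/-!
# Crux `DiluteDWavePairsCondense` (stmt-HubbardSuperconductivity-10771) in NORMAL FORM

Helper for route `ParentFirstSMA` (`--supports stmt-HubbardSuperconductivity-10771`). The crux's
conclusion at `(U, δ)` is the summit's matrix (pair-field long-range order of EVERY admissible
`(2⌊(1-δ)L²/2⌋, S^z = 0)` ground-state sequence along even sides, a `liminf` over sequences). By the
tree's normal form `summitMatrix_iff_everyGSOrder` (`δ ≥ -1`; hard half by a diagonal of near-worst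
ground states, no compactness) it is EQUIVALENT to a finite-volume, uniform, every-ground-state bound
`c L⁴ ≤ re ⟨ψ, Δ_d† Δ_d ψ⟩` eventually in even `L`. Hence:

* `diluteDWavePairsCondense_iff_everyGSOrder` — `DiluteDWavePairsCondense ↔ ∀ U ∈ [12, 24],
  (a) → (b) → (c) → ∃ δ ∈ (0, 1/2), ∃ c > 0, ∃ L₀, ∀ L ≥ L₀ (L ≠ 0, even), ∀ unit sector ground
  state ψ, c L⁴ ≤ re ⟨ψ, Δ_d† Δ_d ψ⟩`.

This is the honest one-line content of the BEC bridge for planners re-lining the crux: any line must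
produce, from the zero-, one- and two-hole hypotheses (a)–(c), a doping `δ` with a UNIFORM order floor over all
sector ground states; the `ρ₂` line `birth` adds to this only the split "macroscopic eigenvalue
(stub 2, proved necessary in `ParentFirstSMADiluteDWavePairsCondenseNecessity`) × `d`-wave overlap
(stub 3)". References: S. Friedli, Y. Velenik (2017) §3.7.2 (LRO as a liminf); D. J. Scalapino,
Phys. Rep. 250 (1995) 329, §2 eq. (2.4). No definition is introduced.
-/

-- the mandated namespace `Summit.<Summit>.<Problem>.Theorems` repeats `HubbardSuperconductivity`
-- (single-problem summit, D-0017), which the `dupNamespace` linter flags on every declaration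
set_option linter.dupNamespace false

noncomputable section

namespace Summit.HubbardSuperconductivity.HubbardSuperconductivity.Theorems.ParentFirstSMA

open Matrix Finset Filter
open Literature.Probability.LatticeModels Literature.MathematicalPhysics.QuantumLattice
open Summit.HubbardSuperconductivity.HubbardSuperconductivity.Theses.ParentFirstSMA
open Summit.HubbardSuperconductivity.TwTipContinuation.Negative (summitMatrix_iff_everyGSOrder)
open scoped ComplexOrder

/-- **`DiluteDWavePairsCondense` in normal form.** The BEC bridge of route `ParentFirstSMA` is
equivalent to: for every `U ∈ [12, 24]`, the hypotheses (a) uniform half-filled charge gap, (b)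
uniform two-hole binding, (c) `d`-coherence of the bound pair imply a doping `δ ∈ (0, 1/2)` and a
constant `c > 0` such that, eventually in even `L`, EVERY normalised ground state `ψ` of
`hubbardTorus 2 L 1 U` in the sector `(2⌊(1-δ)L²/2⌋, S^z = 0)` obeys the volume-order floor
`c L⁴ ≤ re ⟨ψ, Δ_d† Δ_d ψ⟩` (`Δ_d = pairField dWaveFormFactor L`). Pointwise in `(U, δ)` this is the
tree's `summitMatrix_iff_everyGSOrder` (`δ > 0 ≥ -1`). [cite: Scalapino1995, §2 eq. (2.4)] -/
theorem diluteDWavePairsCondense_iff_everyGSOrder : Summit.HubbardSuperconductivity.HubbardSuperconductivity.Theses.ParentFirstSMA.DiluteDWavePairsCondense ↔ ∀ U : ℝ, 12 ≤ U → U ≤ 24 → (∃ g : ℝ, 0 < g ∧ ∃ L₀ : ℕ, ∀ L : ℕ, L₀ ≤ L → Even L → g ≤ chargeGap (fermionTorusGraph 2 L) 1 U (L ^ 2)) → (∃ b : ℝ, 0 < b ∧ ∃ L₀ : ℕ, ∀ L : ℕ, L₀ ≤ L → Even L → b ≤ 2 * groundEnergyAt (fermionTorusGraph 2 L) 1 U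 (L ^ 2 - 1) - groundEnergyAt (fermionTorusGraph 2 L) 1 U (L ^ 2) - groundEnergyAt (fermionTorusGraph 2 L) 1 U (L ^ 2 - 2)) → (∃ z : ℝ, 0 < z ∧ ∃ L₀ : ℕ, ∀ (L : ℕ) [NeZero L], L₀ ≤ L → Even L → ∃ φ₂ ψ₀ : Fock (Orb (FermionTorus 2 L)), IsGroundState (hubbardTorus 2 L 1 U) (L ^ 2 - 2) φ₂ ∧ star φ₂ ⬝ᵥ φ₂ = 1 ∧ IsGroundState (hubbardTorus 2 L 1 U) (L ^ 2) ψ₀ ∧ star ψ₀ ⬝ᵥ ψ₀ = 1 ∧ z * (L : ℝ) ^ 2 ≤ ‖star φ₂ ⬝ᵥ (pairField dWaveFormFactor L *ᵥ ψ₀)‖ ^ 2) → ∃ δ ∈ Set.Ioo (0 : ℝ) (1 / 2), ∃ c : ℝ, 0 < c ∧ ∃ L₀ : ℕ, ∀ (L : ℕ) [NeZero L], L₀ ≤ L → Even L → ∀ ψ : Fock (Orb (FermionTorus 2 L)), star ψ ⬝ᵥ ψ = 1 → IsGroundStateInSector (hubbardTorus 2 L 1 U) (2 * ⌊(1 - δ)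 * (L : ℝ) ^ 2 / 2⌋₊) 0 ψ → c * (L : ℝ) ^ 4 ≤ (expect ((pairField dWaveFormFactor L)ᴴ * pairField dWaveFormFactor L) ψ).re := by
  constructor
  · intro h U hU12 hU24 hA hB hC
    obtain ⟨δ, hδ, hS⟩ := h U hU12 hU24 hA hB hC
    exact ⟨δ, hδ, (summitMatrix_iff_everyGSOrder (U := U) (by linarith [hδ.1])).1 hS⟩
  · intro h U hU12 hU24 hA hB hC
    obtain ⟨δ, hδ, hE⟩ := h U hU12 hU24 hA hB hC
    exact ⟨δ, hδ, (summitMatrix_iff_everyGSOrder (U := U) (by linarith [hδ.1])).2 hE⟩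

end Summit.HubbardSuperconductivity.HubbardSuperconductivity.Theorems.ParentFirstSMA

end
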